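import Summits.MatrixMultiplication.OmegaCensus.SmallFormats.MatMul22nRankGF7Slack5SearchSem
import Summits.MatrixMultiplication.OmegaCensus.SmallFormats.MatMul22nRankGF7Slack5WLOG
import HarnessLib

/-!
# ω-census family (a): soundness of the slack-5 search checker — CHECK A semantics (planes), CHECK B induction, `search5_sound`

Cell `pub-omega` (unit `pub-omega-tensor-g16`), topic `Summits/MatrixMultiplication/OmegaCensus` (sub-folder `SmallFormats`).
Framing (verbatim): lottery ticket; floor = certified bounds/negative ranges. HONEST FRAMING: kernel infrastructure — the soundness theorem of
`MatMul22nRankGF7Slack5Search` (`pub-omega-tensor-g16/KERNEL-S5-DESIGN.md`): if `levelsOK5n h = true` for every element `h < 336` (CHECK A)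
and `search5 c = true` (CHECK B) then no LP-tight point of the slack-5 `𝔽₇` X-cap system has torus-0 column `repVal5 c`. The replayed
`decide`s and the assembly are sibling files. Nothing here is progress on `ω`.

* `planeH5n_eq`, `keyPlane5_eq`: the SIMD planes hold, lane by lane, the slot columns and their keys `colKey5` (via `MatMul22nRankGF7Plane`);
* `slotOK5_of_levelsOK5`, `child_of_hit`: CHECK A delivers, for every slot whose key is visited, a bucket entry with the same column;
* `srch5_sound`: induction over the levels with the invariant 'the packed columns are the true coset counts of the levels so far'
  (`relNeed5_eq`, `det_coord5_eq` of `MatMul22nRankGF7Slack5SearchSem`; `slot_of_pat5`, `slack5_tight_cols7`).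
-/

namespace Summit.MatrixMultiplication.OmegaCensus.SmallFormats

open Finset
open Literature.NumberTheory.NumberFields (list_sum_range_map)

set_option exponentiation.threshold 100000

/-! ## Keys of columns -/

/-- The key of a 42-vector `Q` at bucket level `L`: `Σ_i ((Σ_z g_{r_i} z · Q z) % 7)·7^i` over the cross relations `r_i` of `L`. -/
def colKey5 (L : ℕ) (Q : ℕ → ℕ) : ℕ := ∑ i ∈ range (crossCnt5 L), (∑ z ∈ range 42, gco5 (crossIdx5 L i) z * Q z) % 7 * 7 ^ i

/-- `crossCnt5 L ≤ 12`. -/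
theorem crossCnt5_le (L : ℕ) : crossCnt5 L ≤ 12 := by
  unfold crossCnt5
  rcases L with _ | _ | _ | _ | _ | _ | _ | _ | L <;> simp

/-- Keys are `< 2^34` (`7^12 < 2^34`). -/
theorem colKey5_lt (L : ℕ) (Q : ℕ → ℕ) : colKey5 L Q < 2 ^ 34 := by
  have h7 : ∀ m : ℕ, ∑ i ∈ range m, (6 : ℕ) * 7 ^ i < 7 ^ m := by
    intro m; induction m with
    | zero => simp
    | succ m ih => rw [sum_range_succ, pow_succ]; omega
  have hle : colKey5 L Q ≤ ∑ i ∈ range (crossCnt5 L), 6 * 7 ^ i := by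
    unfold colKey5
    exact sum_le_sum fun i _ => Nat.mul_le_mul_right _ (by have := Nat.mod_lt (∑ z ∈ range 42, gco5 (crossIdx5 L i) z * Q z) (by norm_num : 0 < 7); omega)
  have hm := crossCnt5_le L
  calc colKey5 L Q < 7 ^ crossCnt5 L := lt_of_le_of_lt hle (h7 _)
    _ ≤ 7 ^ 12 := Nat.pow_le_pow_right (by norm_num) hm
    _ < 2 ^ 34 := by norm_num

/-- The key only depends on the 42 values. -/
theorem colKey5_congr (L : ℕ) {Q Q' : ℕ → ℕ} (h : ∀ z < 42, Q z = Q' z) : colKey5 L Q = colKey5 L Q' := by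
  unfold colKey5
  exact sum_congr rfl fun i _ => by rw [sum_congr rfl fun z hz => by rw [h z (mem_range.1 hz)]]

/-! ## CHECK A semantics: the planes -/

/-- Representative values are 3-bit digits, hence `< 8`. -/
theorem repVal5_lt8 (c z : ℕ) : repVal5 c z < 8 := by unfold repVal5; exact fld3_lt _ _

/-- The (nested) plane of representatives, lane by lane. -/
theorem PID5n_eq : PID5n = packW 588 (fun c => packW 14 (repVal5 c) 42) 656 := by
  unfold PID5n repCol5 packW
  rw [list_sum_range_map]
  exact sum_congr rfl fun c _ => by rw [list_sum_range_map]

/-- **The plane of element `h`** holds in lane `c` the packed slot column `z ↦ repVal5 c (omAct7 h z)`. -/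
theorem planeH5n_eq {h : ℕ} (hh : h < 336) : planeH5n h = packW 588 (fun c => packW 14 (fun z => repVal5 c (omAct7 h z)) 42) 656 := by
  obtain ⟨_, hact⟩ := omAct7_ok ⟨h, hh⟩
  have hlane : ∀ c < 656, (fun c => packW 14 (repVal5 c) 42) c < 2 ^ 588 := fun c _ =>
    packW_lt (W := 14) _ 42 fun z _ => lt_trans (repVal5_lt8 c z) (by norm_num)
  unfold planeH5n
  rw [← plane_place (fun z c => repVal5 c (omAct7 h z)) 656]
  refine congrArg List.sum (List.map_congr_left fun z hz => ?_)
  have hz42 := List.mem_range.1 hz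
  have ha : omAct7 h z < 42 := (hact ⟨z, hz42⟩).2
  rw [PID5n_eq, plane_shift_mask hlane le_rfl (by omega)]
  refine congrArg (· * 2 ^ (14 * z)) (packW_congr 588 fun c _ => ?_)
  show packW 14 (repVal5 c) 42 >>> (14 * omAct7 h z) % 2 ^ 14 = repVal5 c (omAct7 h z)
  have e : packW 14 (repVal5 c) 42 >>> (14 * omAct7 h z) % 2 ^ 14 = fld 14 (packW 14 (repVal5 c) 42) (omAct7 h z) := by
    rw [fldW_eq, Nat.shiftRight_eq_div_pow]
  rw [e, fld_packW _ (fun i _ => lt_trans (repVal5_lt8 c i) (by norm_num)), if_pos ha]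

/-- `relG5 r` is the reversed packing of its coefficient digits `gco5 r`. -/
theorem relG5_eq {r : ℕ} (hr : r < 284) : relG5 r = packW 14 (fun j => gco5 r (41 - j)) 42 := by
  obtain ⟨_, _, _, _, _, hGlt⟩ := relFG5_ok hr
  have hself : packW 14 (fun j => fld 14 (relG5 r) j) 42 = relG5 r :=
    packW_fld_self (W := 14) (by norm_num) (by rw [show 14 * 42 = 588 by norm_num]; exact hGlt)
  rw [← hself]
  refine packW_congr 14 fun j hj => ?_
  show fld 14 (relG5 r) j = gco5 r (41 - j)
  unfold gco5; rw [show 41 - (41 - j) = j by omega]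

/-- **The key plane of a bucket level** holds in lane `c` the key of the slot column `(c, h)`. -/
theorem keyPlane5_eq {L : ℕ} (hL : L < 8) {h : ℕ} (hh : h < 336) :
    keyPlane5 L (planeH5n h) = packW 588 (fun c => colKey5 L (fun z => repVal5 c (omAct7 h z))) 656 := by
  have hrep := repVal5_le
  unfold keyPlane5 colKey5
  rw [← plane_lincomb (fun i c => (∑ z ∈ range 42, gco5 (crossIdx5 L i) z * repVal5 c (omAct7 h z)) % 7) (fun i => 7 ^ i) (crossCnt5 L) 656]
  refine congrArg List.sum (List.map_congr_left fun i hi => ?_)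
  have hi' := List.mem_range.1 hi
  have hi12 : i < 12 := lt_of_lt_of_le hi' (crossCnt5_le L)
  obtain ⟨hr, _⟩ := crossIdx5_ok ⟨L, hL⟩ ⟨i, hi12⟩ hi'
  obtain ⟨_, hact⟩ := omAct7_ok ⟨h, hh⟩
  have hp : ∀ c < 656, ∀ z < 42, (fun c z => repVal5 c (omAct7 h z)) c z ≤ 5 := fun c hc z hz => by
    show repVal5 c (omAct7 h z) ≤ 5
    exact hrep ⟨c, hc⟩ ⟨omAct7 h z, (hact ⟨z, hz⟩).2⟩
  have hl : ∀ z < 42, gco5 (crossIdx5 L i) z ≤ 6 := (co5_le hr).2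
  rw [planeH5n_eq hh, relG5_eq hr, plane_dot hp hl]
  have hv : ∀ c < 656, (fun c => ∑ z ∈ range 42, repVal5 c (omAct7 h z) * gco5 (crossIdx5 L i) z) c < 2 ^ 14 := by
    intro c hc
    show ∑ z ∈ range 42, repVal5 c (omAct7 h z) * gco5 (crossIdx5 L i) z < 2 ^ 14
    calc ∑ z ∈ range 42, repVal5 c (omAct7 h z) * gco5 (crossIdx5 L i) z ≤ ∑ z ∈ range 42, 5 * 6 :=
          sum_le_sum fun z hz => Nat.mul_le_mul (hp c hc z (mem_range.1 hz)) (hl z (mem_range.1 hz))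
      _ < 2 ^ 14 := by simp
  rw [plane_resid hv]
  exact congrArg (· * 7 ^ i) (packW_congr 588 fun c _ => congrArg (· % 7) (sum_congr rfl fun z _ => mul_comm _ _))

/-! ## CHECK A: extracting the per-slot facts -/

/-- Shifting a plane right by whole lanes. -/
theorem packW_shiftRight_lanes (f : ℕ → ℕ) (n c : ℕ) (hf : ∀ i < n, f i < 2 ^ 588) :
    packW 588 f n >>> (588 * c) = packW 588 (fun i => f (c + i)) (n - c) := by
  apply Nat.eq_of_testBit_eq
  intro i
  rw [Nat.testBit_shiftRight, testBit_packW (by norm_num) f hf, testBit_packW (by norm_num) _ (fun i hi => hf (c + i) (by omega))]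
  rw [show (588 * c + i) / 588 = c + i / 588 by omega, show (588 * c + i) % 588 = i % 588 by omega]
  by_cases h : i / 588 < n - c
  · simp [h, show c + i / 588 < n by omega]
  · simp [h, show ¬ (c + i / 588 < n) by omega]

/-- Keeping the low `m` lanes of a plane. -/
theorem packW_and_lanes (f : ℕ → ℕ) {n m : ℕ} (hm : m ≤ n) (hf : ∀ i < n, f i < 2 ^ 588) :
    packW 588 f n &&& (2 ^ (588 * m) - 1) = packW 588 f m := by
  rw [Nat.and_two_pow_sub_one_eq_mod]
  apply Nat.eq_of_testBit_eq
  intro i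
  rw [Nat.testBit_mod_two_pow, testBit_packW (by norm_num) f hf, testBit_packW (by norm_num) f (fun i hi => hf i (by omega))]
  by_cases h : i < 588 * m
  · simp [h, show i / 588 < m by omega, show i / 588 < n by omega]
  · simp [h, show ¬ (i / 588 < m) by omega]

/-- **Unfolding `lanes5`**: if the binary-splitting check passes on a plane of `n` lanes with values `< 2^34`, every lane passes `slotOK5`. -/
theorem lanes5_sound (L h : ℕ) : ∀ fuel c n f, (∀ i < n, f i < 2 ^ 34) → lanes5 L h fuel c n (packW 588 f n) = true →
    ∀ i < n, slotOK5 L (c + i) h (f i) = true := by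
  intro fuel
  induction fuel with
  | zero => intro c n f _ hl; simp [lanes5] at hl
  | succ fuel ih =>
    intro c n f hf hl i hi
    have hf588 : ∀ i < n, f i < 2 ^ 588 := fun i hi => lt_trans (hf i hi) (by norm_num)
    unfold lanes5 at hl
    by_cases hn0 : n = 0
    · omega
    rw [if_neg hn0] at hl
    by_cases hn1 : n = 1
    · rw [if_pos hn1] at hl
      subst hn1
      have hi0 : i = 0 := by omega
      subst hi0
      rw [show packW 588 f 1 = packW 588 f (0 + 1) from rfl, plane_peel_read f 0 hf588 (hf 0 (by omega))] at hl
      simpa using hl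
    rw [if_neg hn1, Bool.and_eq_true] at hl
    obtain ⟨h1, h2⟩ := hl
    rw [packW_and_lanes f (show n / 2 ≤ n by omega) hf588] at h1
    rw [packW_shiftRight_lanes f n (n / 2) hf588] at h2
    by_cases hlow : i < n / 2
    · exact ih c (n / 2) f (fun j hj => hf j (by omega)) h1 i hlow
    · have h3 := ih (c + n / 2) (n - n / 2) (fun j => f (n / 2 + j)) (fun j hj => hf _ (by omega)) h2 (i - n / 2) (by omega)
      rw [show c + n / 2 + (i - n / 2) = c + i by omega, show n / 2 + (i - n / 2) = i by omega] at h3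
      exact h3

/-- **CHECK A per slot.** If `levelsOK5n h` then for every bucket level `L` and class `c` the slot `(c, h)` passes `slotOK5` at its key. -/
theorem slotOK5_of_levelsOK5 {h : ℕ} (hh : h < 336) (hA : levelsOK5n h = true) {L : ℕ} (hL : L ∈ [1, 2, 3, 4, 5, 7]) {c : ℕ} (hc : c < 656) :
    slotOK5 L c h (colKey5 L (fun z => repVal5 c (omAct7 h z))) = true := by
  unfold levelsOK5n at hA
  have hLall := List.all_eq_true.1 hA L hL
  have hL8 : L < 8 := by simp at hL; omega
  rw [keyPlane5_eq hL8 hh] at hLall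
  have h1 := lanes5_sound L h 12 0 656 (fun c => colKey5 L (fun z => repVal5 c (omAct7 h z))) (fun i _ => colKey5_lt L _) hLall c hc
  rw [zero_add] at h1
  exact h1

set_option maxRecDepth 100000 in
set_option maxHeartbeats 40000000 in
/-- Every visited key is flagged by its level's bitmap (levels 1–3). -/
theorem visMaybe5_ok_1 : (∀ n : Fin 562, visMaybe5 1 (visKey5 1 n.val) = true) ∧ (∀ n : Fin 9469, visMaybe5 2 (visKey5 2 n.val) = true)
    ∧ ∀ n : Fin 4810, visMaybe5 3 (visKey5 3 n.val) = true := by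
  refine ⟨by decide +kernel, by decide +kernel, by decide +kernel⟩

set_option maxRecDepth 100000 in
set_option maxHeartbeats 40000000 in
/-- Every visited key is flagged by its level's bitmap (levels 4, 5, 7); the key counts per level. -/
theorem visMaybe5_ok_2 : (∀ n : Fin 3732, visMaybe5 4 (visKey5 4 n.val) = true) ∧ (∀ n : Fin 76, visMaybe5 5 (visKey5 5 n.val) = true)
    ∧ (∀ n : Fin 1, visMaybe5 7 (visKey5 7 n.val) = true)
    ∧ visCnt5 1 = 562 ∧ visCnt5 2 = 9469 ∧ visCnt5 3 = 4810 ∧ visCnt5 4 = 3732 ∧ visCnt5 5 = 76 ∧ visCnt5 7 = 1 := by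
  refine ⟨by decide +kernel, by decide +kernel, by decide +kernel, by decide⟩

/-- A visited key passes the bitmap pre-filter. -/
theorem visMaybe5_of_visited5 {L : ℕ} (hL : L ∈ [1, 2, 3, 4, 5, 7]) {key : ℕ} (hv : visited5 L key = true) : visMaybe5 L key = true := by
  unfold visited5 at hv
  rw [Bool.and_eq_true, decide_eq_true_eq, beq_iff_eq] at hv
  obtain ⟨hn, hk⟩ := hv
  rw [← hk]
  obtain ⟨a1, a2, a3⟩ := visMaybe5_ok_1
  obtain ⟨a4, a5, a7, c1, c2, c3, c4, c5, c7⟩ := visMaybe5_ok_2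
  simp only [List.mem_cons, List.not_mem_nil, or_false] at hL
  rcases hL with rfl | rfl | rfl | rfl | rfl | rfl
  · rw [c1] at hn; exact a1 ⟨_, hn⟩
  · rw [c2] at hn; exact a2 ⟨_, hn⟩
  · rw [c3] at hn; exact a3 ⟨_, hn⟩
  · rw [c4] at hn; exact a4 ⟨_, hn⟩
  · rw [c5] at hn; exact a5 ⟨_, hn⟩
  · rw [c7] at hn; exact a7 ⟨_, hn⟩

/-- **A hit yields a bucket entry of the same class with the same column.** -/
theorem child_of_hit {L c h key : ℕ} (hhit : slotHit5 L c h key = true) :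
    ∃ e ∈ bucket5 L key, e / 512 = c ∧ ∀ z < 42, repVal5 c (omAct7 (e % 512) z) = repVal5 c (omAct7 h z) := by
  unfold slotHit5 at hhit
  rw [List.any_eq_true] at hhit
  obtain ⟨e, he, h2⟩ := hhit
  rw [Bool.and_eq_true, beq_iff_eq, List.all_eq_true] at h2
  exact ⟨e, he, h2.1, fun z hz => by have := h2.2 z (List.mem_range.2 hz); rwa [beq_iff_eq] at this⟩

/-! ## CHECK B: the search is sound -/

/-- The packed column of a slot as a packing. -/
theorem colOfSlot5_eq (c h : ℕ) : colOfSlot5 c h = packW 14 (fun z => repVal5 c (omAct7 h z)) 42 := by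
  unfold colOfSlot5 packW; rw [list_sum_range_map]

/-- Reading a mapped range list. -/
theorem getD_map_range42 (f : ℕ → ℕ) {k : ℕ} (hk : k < 42) : ((List.range 42).map f).getD k 0 = f k := by
  rw [List.getD_eq_getElem?_getD, List.getElem?_map, List.getElem?_range hk]; rfl

/-- The packed column of a list of 42 values given by a function. -/
theorem listCol5_map (f : ℕ → ℕ) : listCol5 ((List.range 42).map f) = packW 14 f 42 := by
  unfold listCol5 packW
  rw [list_sum_range_map]
  exact sum_congr rfl fun z hz => by rw [getD_map_range42 f (mem_range.1 hz)]

/-- **Soundness of `srch5`.** At an LP-tight point of slack 5, the search started on the true packed columns of the levels `< L`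
(`1 ≤ L`) cannot return `true` — provided CHECK A holds for every element. -/
theorem srch5_sound (hA : ∀ h < 336, levelsOK5n h = true) (x : ℕ → ℕ) (hrows : ∀ r < 1274, capRowVal7 x r ≤ rhs7s 5 r)
    (hge : (260 : ℤ) ≤ ∑ j ∈ range 401, (x j : ℤ)) :
    ∀ fuel L, 1 ≤ L → srch5 fuel L (colsPack5 x L) = true → False := by
  -- tight-point facts
  obtain ⟨_, hT, hR, _, _⟩ := tight7_of_total_ge 5 x hrows (by push_cast; linarith)
  have hpat : ∀ j < 21, IsPat7 5 (colN7 x j) := fun j hj => slack5_tight_cols7 x hrows hge hj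
  have hx : ∀ j < 21, ∀ z < 42, colN7 x j z ≤ 5 := fun j hj z hz => (hpat j hj).1 z hz
  have hT' : ∀ t < 384, xrs7 x t = 5 := fun t ht => by exact_mod_cast hT t ht
  intro fuel
  induction fuel with
  | zero => intro L _ h; simp [srch5] at h
  | succ fuel ih =>
    intro L hL1 h
    rw [srch5] at h
    by_cases h9 : 9 ≤ L
    · rw [if_pos h9] at h; exact Bool.false_ne_true h
    rw [if_neg h9] at h
    have hL8 : L ≤ 8 := by omega
    have htor : torOf5 L < 21 := (torOf5_ok ⟨L, by omega⟩).1
    by_cases hdet : isDet5 L = true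
    · -- determined level: the computed values ARE the true column
      rw [if_pos hdet] at h
      have hL68 : L = 6 ∨ L = 8 := by
        unfold isDet5 at hdet; rw [Bool.or_eq_true, beq_iff_eq, beq_iff_eq] at hdet; exact hdet
      have hvals : detVals5 L (colsPack5 x L) = (List.range 42).map (colN7 x (torOf5 L)) := by
        unfold detVals5
        apply List.map_congr_left
        intro z hz
        exact (det_coord5_eq hL68 x hx hT' hR (List.mem_range.1 hz)).symm
      rw [hvals] at h
      have hall : (((List.range 42).map (colN7 x (torOf5 L))).all (· ≤ 5)) = true := by
        rw [List.all_eq_true]; intro v hv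
        rw [List.mem_map] at hv; obtain ⟨z, hz, rfl⟩ := hv
        exact decide_eq_true (hx _ htor _ (List.mem_range.1 hz))
      have hhept : heptOK5 ((List.range 42).map (colN7 x (torOf5 L))) = true := by
        unfold heptOK5
        rw [List.all_eq_true]; intro hb hhb
        have hhb' := List.mem_range.1 hhb
        rw [beq_iff_eq, list_sum_range_map]
        have e : ∀ i ∈ range 7, ((List.range 42).map (colN7 x (torOf5 L))).getD (heptPt7 (hb / 6) (hb % 6) i) 0
            = colN7 x (torOf5 L) (heptPt7 (hb / 6) (hb % 6) i) := fun i hi =>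
          getD_map_range42 _ (heptPt7_lt ⟨hb / 6, by omega⟩ ⟨hb % 6, Nat.mod_lt _ (by norm_num)⟩ ⟨i, mem_range.1 hi⟩)
        rw [sum_congr rfl e]
        exact (hpat _ htor).2 (hb / 6) (by omega) (hb % 6) (Nat.mod_lt _ (by norm_num))
      rw [hall, hhept] at h
      simp only [Bool.not_true, Bool.false_or] at h
      rw [listCol5_map, show packW 14 (colN7 x (torOf5 L)) 42 = colPack5 x (torOf5 L) from rfl, ← colsPack5_succ] at h
      exact ih (L + 1) (by omega) h
    · -- bucket level
      rw [if_neg hdet] at h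
      rw [Bool.and_eq_true] at h
      obtain ⟨hvis, hallb⟩ := h
      have hLmem : L ∈ [1, 2, 3, 4, 5, 7] := by
        unfold isDet5 at hdet; rw [Bool.or_eq_true, beq_iff_eq, beq_iff_eq] at hdet
        simp only [List.mem_cons, List.not_mem_nil, or_false]; omega
      have hLlt8 : L < 8 := by
        unfold isDet5 at hdet; rw [Bool.or_eq_true, beq_iff_eq, beq_iff_eq] at hdet; omega
      -- the true column of this level is a slot pattern
      obtain ⟨c, hc, hh, hhh, hQ⟩ := slot_of_pat5 (hpat _ htor)
      -- its key is the need key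
      have hkey : colKey5 L (fun z => repVal5 c (omAct7 hh z)) = needKey5 L (colsPack5 x L) := by
        rw [← colKey5_congr L hQ]
        unfold colKey5 needKey5
        rw [list_sum_range_map]
        refine sum_congr rfl fun i hi => ?_
        have hi' := mem_range.1 hi
        have hi12 : i < 12 := lt_of_lt_of_le hi' (crossCnt5_le L)
        obtain ⟨hr, hlev⟩ := crossIdx5_ok ⟨L, hLlt8⟩ ⟨i, hi12⟩ hi'
        have hne := (relNeed5_eqL hr hlev x hx hT' hR).1
        rw [hne]
      -- CHECK A gives a hit
      have hslot := slotOK5_of_levelsOK5 hhh (hA hh hhh) hLmem hc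
      rw [hkey] at hslot
      unfold slotOK5 at hslot
      rw [visMaybe5_of_visited5 hLmem hvis, hvis] at hslot
      simp only [Bool.not_true, Bool.false_or] at hslot
      obtain ⟨e, he, hec, hez⟩ := child_of_hit hslot
      -- the child of that entry carries the true column
      have hchild := List.all_eq_true.1 hallb e he
      have hcol : colOfSlot5 (e / 512) (e % 512) = colPack5 x (torOf5 L) := by
        rw [hec, colOfSlot5_eq]
        exact packW_congr 14 fun z hz => by rw [hez z hz, ← hQ z hz]
      rw [hcol, ← colsPack5_succ] at hchild
      exact ih (L + 1) (by omega) hchild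

/-- **Soundness of the slack-5 search certificate.** If CHECK A holds for all 336 elements and `search5 c = true`, then no LP-tight point
of the slack-5 `𝔽₇` X-cap system (box `[0,5]`, the 1274 rows, total `≥ 260`) has torus-0 column `repVal5 c`. -/
theorem search5_sound (hA : ∀ h < 336, levelsOK5n h = true) {c : ℕ} (hs : search5 c = true) (x : ℕ → ℕ) (_hbox : ∀ j, x j ≤ 5)
    (hrows : ∀ r < 1274, capRowVal7 x r ≤ rhs7s 5 r) (hge : (260 : ℤ) ≤ ∑ j ∈ range 401, (x j : ℤ))
    (hcol : ∀ z < 42, colN7 x 0 z = repVal5 c z) : False := by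
  unfold search5 at hs
  have e : repCol5 c = colsPack5 x 1 := by
    unfold repCol5 colsPack5 colPack5
    rw [list_sum_range_map]
    unfold packW
    rw [sum_range_one]
    simp only [show torOf5 0 = 0 from rfl, mul_zero, pow_zero, mul_one]
    exact sum_congr rfl fun z hz => by rw [hcol z (mem_range.1 hz)]
  rw [e] at hs
  exact srch5_sound hA x hrows hge 9 1 le_rfl hs

end Summit.MatrixMultiplication.OmegaCensus.SmallFormats
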